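import Summits.BirchSwinnertonDyer.BirchSwinnertonDyer.Theorems.SignedLowerHalvesSmallImageLowerHalfBothSignsRttD2TwistLevel
import Literature.NumberTheory.ComplexMultiplication.EllipticUnits.ImaginaryQuadraticMainConjectureClassGroupRowLayers
import HarnessLib

/-!
# Route `SignedLowerHalves`, crux L `SmallImageLowerHalfBothSigns` (stmt-BirchSwinnertonDyer-23599), line `rtt_w3` v14 — E2, row «D-tw-coh» part 2c(iii):
# the THRESHOLDS `m(k)` exist — `θ' ≡ θ (mod p^k)` on `Gal(K̄/K̃_{m(k)})` whenever `θ' = θ` on `Gal(K̄/K̃_∞)`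

INPUTS hand `bsd-inputs-honda-p1` g23 (LEAD g11 RULING «U» (U5)). Discharges the hypotheses `m`, `hmono : Monotone m`, `hm` of `…RttD2TwistTower` / `…RttD2TwistAssembly`
(`twistHom`, `twistEquiv`) from the one structural fact of the junction: `η = θ'/θ` is a character of `Gal(K̃_∞/K)`, i.e. `θ' = θ` on `pairKer κ₁ κ₂ = Gal(K̄/K̃_∞)`.
* ★★ `exists_thresholds` — there is a MONOTONE `m : ℕ → ℕ` with `θ' σ = θ σ + p^k·b` for all `σ ∈ Gal(K̄/K̃_{m(k)})`: continuity of `θ, θ'`, the closed `p^k`-ball of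
  `𝒪 = 𝒪_{ℚ_p(S)}` lies in `p^k𝒪`, and the layers `Gal(K̄/K̃_n)` are cofinal among the open neighbourhoods of `Gal(K̄/K̃_∞)` (tree: `ClassGroupRow.exists_pairLayerSubgroup_subset`,
  compactness of `Γ_K`).
THEOREMS only; no `def`, no named fact, no `sorry`; crux L, crux M, E2 and BSD remain OPEN and are proved for NO curve by any of this.
References: [SerreGaloisCohomology1997] I §2.2 Prop. 8; [JohnsonLeungKings2011] §4.1; [Rubin2000] Ch. VI §6.1.
-/

set_option autoImplicit false
-- the Theorems namespace of this sub repeats the summit name by design (D-0017 nested layout)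
set_option linter.dupNamespace false

noncomputable section

open scoped NumberField
open Field
open Literature.NumberTheory.GaloisRepresentations
open Literature.NumberTheory.EllipticCurves
open Literature.NumberTheory.ComplexMultiplication.EllipticUnits
open Literature.NumberTheory.ComplexMultiplication.EllipticUnits.JohnsonLeungKings2011

namespace Summit.BirchSwinnertonDyer.BirchSwinnertonDyer.Theorems.SmallImageRttD2Twist

variable {K : Type} [Field K] [NumberField K] {p : ℕ} [Fact p.Prime] (S : Set (PadicAlgCl p))
  (κ₁ κ₂ : ZpExtension K p) (θ θ' : absoluteGaloisGroup K →ₜ* (padicCoeffIntegers S)ˣ)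

/-- The closed `p^k`-ball of `𝒪 = 𝒪_{ℚ_p(S)}` lies in `p^k𝒪` (then `x/p^k ∈ ℚ_p(S)` has norm `≤ 1`).
-- adapted from the private `exists_eq_pow_mul_of_norm_le` of `Literature/…/ImaginaryQuadraticMainConjectureCarriersO.lean`
[folklore] -/
theorem exists_eq_pow_mul_of_norm_le' (k : ℕ) (x : padicCoeffIntegers S)
    (hx : ‖(x : PadicAlgCl p)‖ ≤ ‖((p : PadicAlgCl p)) ^ k‖) :
    ∃ b : padicCoeffIntegers S, x = ((p : padicCoeffIntegers S)) ^ k * b := by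
  have hp0 : ((p : PadicAlgCl p)) ^ k ≠ 0 :=
    pow_ne_zero k (Nat.cast_ne_zero.mpr (Fact.out : p.Prime).ne_zero)
  refine ⟨⟨(x : PadicAlgCl p) / (p : PadicAlgCl p) ^ k, ⟨?_, ?_⟩⟩, ?_⟩
  · exact div_mem x.2.1 (pow_mem (IntermediateField.natCast_mem _ p) k)
  · rw [norm_div]
    exact div_le_one_of_le₀ hx (norm_nonneg _)
  · apply Subtype.ext
    change (x : PadicAlgCl p) = ((p : PadicAlgCl p)) ^ k * ((x : PadicAlgCl p) / (p : PadicAlgCl p) ^ k)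
    rw [mul_div_cancel₀ _ hp0]

/-- ★★ **The thresholds exist**: if `θ' = θ` on `Gal(K̄/K̃_∞) = pairKer κ₁ κ₂` (i.e. `η = θ'/θ` is a character of `Gal(K̃_∞/K) ≅ ℤ_p²`), there is a MONOTONE
`m : ℕ → ℕ` such that `θ' ≡ θ (mod p^k)` on `Gal(K̄/K̃_{m(k)})` for every `k` — the hypotheses `m`, `hmono`, `hm` of `twistHom`/`twistEquiv`.
(Continuity of `θ, θ'`; the open set `{σ : ‖θ'σ − θσ‖ < ‖p^k‖} ⊇ Gal(K̄/K̃_∞)` contains a layer by compactness; a running maximum makes `m` monotone.)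
[cite: SerreGaloisCohomology1997, I §2.2 Prop. 8] [cite: JohnsonLeungKings2011, §4.1 (arXiv p0012:L7–14)] [cite: Rubin2000, Ch. VI §6.1] -/
theorem exists_thresholds (hker : ∀ σ ∈ ZpExtension.pairKer κ₁ κ₂, θ' σ = θ σ) :
    ∃ m : ℕ → ℕ, Monotone m ∧ ∀ k, ∀ σ ∈ JohnsonLeungKings2011.pairLayerSubgroup κ₁ κ₂ (m k), ∃ b : padicCoeffIntegers S,
      ((θ' σ : (padicCoeffIntegers S)ˣ) : padicCoeffIntegers S) = (θ σ : (padicCoeffIntegers S)ˣ) + ((p : padicCoeffIntegers S)) ^ k * b := by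
  -- the continuous difference `f σ = θ'σ − θσ ∈ ℚ̄_p`
  have hf : Continuous fun σ : absoluteGaloisGroup K ↦
      ((((θ' σ : (padicCoeffIntegers S)ˣ) : padicCoeffIntegers S)) : PadicAlgCl p) -
        ((((θ σ : (padicCoeffIntegers S)ˣ) : padicCoeffIntegers S)) : PadicAlgCl p) :=
    (continuous_subtype_val.comp (Units.continuous_val.comp θ'.continuous)).sub
      (continuous_subtype_val.comp (Units.continuous_val.comp θ.continuous))
  have hr : ∀ k : ℕ, 0 < ‖((p : PadicAlgCl p)) ^ k‖ := fun k ↦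
    norm_pos_iff.mpr (pow_ne_zero k (Nat.cast_ne_zero.mpr (Fact.out : p.Prime).ne_zero))
  -- each open set `{‖f‖ < ‖p^k‖} ⊇ pairKer` contains a layer
  have hV : ∀ k : ℕ, ∃ n : ℕ, (JohnsonLeungKings2011.pairLayerSubgroup κ₁ κ₂ n : Set (absoluteGaloisGroup K)) ⊆
      (fun σ : absoluteGaloisGroup K ↦
        ((((θ' σ : (padicCoeffIntegers S)ˣ) : padicCoeffIntegers S)) : PadicAlgCl p) -
          ((((θ σ : (padicCoeffIntegers S)ˣ) : padicCoeffIntegers S)) : PadicAlgCl p)) ⁻¹'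
        Metric.ball 0 ‖((p : PadicAlgCl p)) ^ k‖ := fun k ↦
    ClassGroupRow.exists_pairLayerSubgroup_subset p κ₁ κ₂ (Metric.isOpen_ball.preimage hf) fun σ hσ ↦ by
      rw [Set.mem_preimage, Metric.mem_ball, dist_zero_right, hker σ hσ, sub_self, norm_zero]
      exact hr k
  choose m₀ hm₀ using hV
  refine ⟨fun k ↦ (Finset.range (k + 1)).sup m₀,
    fun a b hab ↦ Finset.sup_mono (Finset.range_mono (Nat.succ_le_succ hab)), fun k σ hσ ↦ ?_⟩
  have hσ' : σ ∈ JohnsonLeungKings2011.pairLayerSubgroup κ₁ κ₂ (m₀ k) :=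
    JohnsonLeungKings2011.pairLayerSubgroup_antitone κ₁ κ₂
      (Finset.le_sup (f := m₀) (Finset.mem_range.mpr (Nat.lt_succ_self k))) hσ
  have hlt := hm₀ k hσ'
  rw [Set.mem_preimage, Metric.mem_ball, dist_zero_right] at hlt
  have hle : ‖((((θ' σ : (padicCoeffIntegers S)ˣ) : padicCoeffIntegers S) - (θ σ : (padicCoeffIntegers S)ˣ) :
      padicCoeffIntegers S) : PadicAlgCl p)‖ ≤ ‖((p : PadicAlgCl p)) ^ k‖ := by
    rw [AddSubgroupClass.coe_sub]
    exact hlt.le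
  obtain ⟨b, hb⟩ := exists_eq_pow_mul_of_norm_le' S k _ hle
  exact ⟨b, by rw [← hb]; ring⟩

end Summit.BirchSwinnertonDyer.BirchSwinnertonDyer.Theorems.SmallImageRttD2Twist

end
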